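import Literature.Geometry.Riemannian.RelativeL2HarmonicOneForms
import HarnessLib

/-!
# `L²` harmonic `1`-forms under a Sobolev inequality: finiteness and ends (Carron 1998, 1999)

For a complete Riemannian manifold `(X, h)` write `ℋ¹(X, h)` for the space of `L²` harmonic
`1`-forms (`L²` covector fields `α` with `dα = 0` and `d*α = 0`; Carron 2007, §1.1.3 (b)); by the
Hodge–de Rham–Gaffney decomposition it computes the first reduced `L²` cohomology group
`H¹₂(X) ≅ ℋ¹(X, h)` of a complete manifold (Carron 2007, Cor. 1.6). G. Carron proved:

* (*ends*) if `(X, h)` is complete, connected and satisfies the Sobolev inequality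
  `(S_p)  μ (∫_X |u|^{2p/(p-2)} dV_h)^{1-2/p} ≤ ∫_X |du|²_h dV_h  (u ∈ C_c^∞(X))` for some `p > 2`,
  `μ > 0`, then the natural map `H¹_c(X) → H¹₂(X)` is injective (Carron 1998, Thm. 0.3 = Thm. 3.3,
  first assertion; Carron 2007, Prop. 2.11), whence, as `k` ends give `k - 1` independent classes in
  `H¹_c(X)` (Carron 2007, Lemma 2.1; the count `b' - 1 ≤ dim H¹_c` in the proof of Carron 1998,
  Thm. 3.3), `#ends(X) - 1 ≤ dim ℋ¹(X, h)` (printed verbatim as Cor. 4.6 of Carron's habilitation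
  memoir: "dim H¹(M) ≥ b - 1");
* (*finiteness*) if `(X, h)` is complete, satisfies `(S_p)` and the curvature term `R_k` of the
  Bochner–Weitzenböck formula on `k`-forms is in `L^{p/2}`, then the space of `L²` harmonic
  `k`-forms is finite dimensional, with dimension bounded by a constant depending only on `(p, k, n)`
  and `μ` times `∫_X |R_k|^{p/2} dV_h` (Carron 1999 = reference [C4] of the memoir, restated there as
  Thm. 4.3; reviewed in Zbl 0933.35054); for `k = 1`, `R_1 = Ric` is the Ricci endomorphism.

This file vendors these two results for `1`-forms, in the vocabulary of
`Literature.Geometry.Riemannian.RelativeL2HarmonicOneForms` (covariant derivative of `1`-forms,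
`ℋ¹_rel(Ω, h)`; here `Ω = X`, no boundary) and of the pseudo-Riemannian prelude
`Literature/Geometry/Lorentzian/` (`PseudoRiemannianMetric.ofRiemannian h`, its Levi-Civita
connection, `ricci`, `normSq`, `innerDual`, `riemannianMeasure h`, `IsGeodesicallyComplete`):

* `HasAtLeastEnds X k` — `X` has at least `k` ends (Carron 2007, §2.1.1), with
  `hasAtLeastEnds_zero`, `HasAtLeastEnds.of_le`, `not_hasAtLeastEnds_succ` (compact ⇒ no end);
* `l2HarmonicOneForms h = ℋ¹(X, h) := relativeL2HarmonicOneForms h ⊤` and the unfolding lemma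
  `mem_l2HarmonicOneForms_iff` (the boundary clauses of `ℋ¹_rel` are void for `Ω = X`);
* `HasSobolevInequality h p μ` — the Sobolev inequality `(S_p)` with constant `μ`;
* the named facts `Carron1998_ends_le_rank_l2HarmonicOneForms` (ends) and
  `Carron1999_finrank_l2HarmonicOneForms_le` (finiteness, `k = 1`), and the proved corollary
  `ends_le_of_Carron1998_of_Carron1999` (`#ends ≤ 1 + C ∫ |Ric|^{p/2}`, the last assertion of
  Carron 1998, Thm. 3.3, and Cor. 4.6 of the memoir, in the shape permitted by the constants below).

Requested (work item `wi-21738`) by route `HarmonicFluxCensus` of the Final State Conjecture, which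
transplants the finiteness bound to exteriors of horizons (`ℋ¹_rel(Ω)`, with a boundary term).

## On the constants (read before sharpening)

The primary source Carron 1999 (Math. Ann. 314, 613–639) is not held (paywalled; acquisition
request `acq-02903`). The shape of its dimension bound is printed differently in the sources that
were read: the review Zbl 0933.35054 of Carron 1999 prints
`dim ℋᵏ(M) ≤ Cₙᵏ C(p,n) μ_p(M)^{-p/2} ∫_M |R|^{p/2}` (full curvature tensor `R`), whereas the author's
copy of Carron 1998 (Thm. 0.3/3.3, citing "(2.5) de [C]" = Carron 1999) and the memoir (Thm. 4.3)
print the factor `μ_p(M)^{-1}` (with `ric₋`, resp. `R_k`); only the exponent `-p/2` is invariant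
under scaling of the quadratic form. The facts below therefore assert only what every printed
version implies: a constant depending on `(n, p, μ)` alone, linear dependence on `∫ |Ric|^{p/2}`.
Likewise the curvature hypothesis is taken in the memoir's form `∫ |R_1|^{p/2} < ∞`, `R_1 = Ric`
(the Duke statement with the negative part `ric₋ ∈ L^{p/2} ∩ L^{p/2+ε}` is not vendored), and
`|Ric|` is the Hilbert–Schmidt norm `normSq^{1/2}` of the prelude (equivalent to the operator norm
of `R_1` up to a factor `√n`, absorbed in the constant).

## Not here

No Hodge theory (`H¹₂ ≅ ℋ¹`, closed range), no `k`-forms for `k ≥ 2`, no relative version on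
domains `Ω ⊊ X` (the route's own item), no Cwikel–Lieb–Rozenblum machinery, no proof.

## References

* G. Carron, *Une suite exacte en L²-cohomologie*, Duke Math. J. 95 (1998) 343–372, Thm. 0.3 =
  Thm. 3.3 and its proof (p. 21–22 of the author's copy). [`Carron1998`]
* G. Carron, *L²-cohomologie et inégalités de Sobolev*, Math. Ann. 314 (1999) 613–639 (main
  theorem; review Zbl 0933.35054). [`Carron1999`]
* G. Carron, *Formes harmoniques L² sur les variétés riemanniennes non-compactes*, mémoire
  d'habilitation (1999) = Rend. Mat. Appl. (7) 21 (2001) 87–119, §4.b Thm. 4.3, §4.c Prop. 4.5,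
  Cor. 4.6 (memoir numbering). [`Carron1999HdR`]
* G. Carron, *Inégalités de Sobolev et L²-cohomologie*, Sémin. Théor. Spectr. Géom. 13 (1995)
  171–176, Thm. A (announcement). [`Carron1995`]
* G. Carron, *L² harmonic forms on non-compact Riemannian manifolds*, arXiv:0704.3194, §1.1.3 (b),
  Cor. 1.6, §2.1.1, Lemma 2.1, Prop. 2.11. [`Carron2007`]
-/

noncomputable section

open Bundle Set Function Filter
open scoped Manifold ContDiff Topology ENNReal NNReal

namespace Literature.Geometry.Riemannian

open _root_.MeasureTheory Literature.Geometry.Lorentzian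

/-! ### Ends of a topological space -/

section Ends

variable (X : Type*) [TopologicalSpace X]

/-- **`X` has at least `k` ends**: there is a compact set `K ⊆ X` such that `X ∖ K` has at least
`k` *unbounded* connected components — witnessed by `k` points of `X ∖ K` whose connected components
in `X ∖ K` are pairwise distinct and unbounded, where a subset is *bounded* when its closure is
compact. (Carron: `M` has `k` ends if for some compact `K₀` and every compact `K ⊇ K₀`, `M ∖ K` has
exactly `k` unbounded connected components; "at least `k` ends" is what the proof of his Lemma 2.1
uses: a compact `K` with `M ∖ K = U₁ ⊔ … ⊔ U_k`, `Uᵢ` unbounded.) Carron 2007, §2.1.1 and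
Lemma 2.1. [cite: Carron2007, §2.1.1] -/
def HasAtLeastEnds (k : ℕ) : Prop :=
  ∃ K : Set X, IsCompact K ∧ ∃ s : Finset X, s.card = k ∧ (↑s : Set X) ⊆ Kᶜ ∧
    (∀ x ∈ s, ¬ IsCompact (closure (connectedComponentIn Kᶜ x))) ∧
    (↑s : Set X).Pairwise fun x y ↦ connectedComponentIn Kᶜ x ≠ connectedComponentIn Kᶜ y

/-- Every space has at least `0` ends. [folklore] -/
theorem hasAtLeastEnds_zero : HasAtLeastEnds X 0 :=
  ⟨∅, isCompact_empty, ∅, rfl, by simp, by simp, by simp⟩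

variable {X}

/-- "At least `k` ends" is antitone in `k`. [folklore] -/
theorem HasAtLeastEnds.of_le {j k : ℕ} (hk : HasAtLeastEnds X k) (hjk : j ≤ k) :
    HasAtLeastEnds X j := by
  obtain ⟨K, hK, s, hcard, hsub, hunb, hpw⟩ := hk
  obtain ⟨t, hts, htcard⟩ := Finset.exists_subset_card_eq (s := s) (hcard ▸ hjk)
  exact ⟨K, hK, t, htcard, (Finset.coe_subset.2 hts).trans hsub, fun x hx ↦ hunb x (hts hx),
    hpw.mono (Finset.coe_subset.2 hts)⟩

variable (X) in
/-- A compact space has no end ("a compact manifold is a manifold with zero end", Carron 2007,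
§2.1.1): every subset is bounded. [cite: Carron2007, §2.1.1] -/
theorem not_hasAtLeastEnds_succ [CompactSpace X] (k : ℕ) : ¬ HasAtLeastEnds X (k + 1) := by
  rintro ⟨K, -, s, hcard, -, hunb, -⟩
  obtain ⟨x, hx⟩ := Finset.card_pos.1 (by rw [hcard]; exact Nat.succ_pos k)
  exact hunb x hx isClosed_closure.isCompact

end Ends

/-! ### `ℋ¹(X, h)` and the Sobolev inequality -/

section L2Harmonic

variable {E : Type*} [NormedAddCommGroup E] [NormedSpace ℝ E] {H : Type*} [TopologicalSpace H]
  {I : ModelWithCorners ℝ E H} {X : Type*} [TopologicalSpace X] [ChartedSpace H X]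
  [IsManifold I ∞ X]
variable [FiniteDimensional ℝ E] [T3Space X] [MeasurableSpace X] [BorelSpace X]
  (h : ContMDiffRiemannianMetric I ∞ E (TangentSpace I : X → Type _))

/-- **The Sobolev inequality `(S_p)` with constant `μ`** on `(X, h)`: for every `u ∈ C_c^∞(X)`,
`μ (∫_X |u|^{2p/(p-2)} dV_h)^{1-2/p} ≤ ∫_X |du|²_h dV_h`, with `|du|²_h = h⁻¹(du, du)` and `dV_h` the
Riemannian measure; meaningful for `p > 2`, `μ > 0` (on an `n`-manifold it forces `p ≥ n`).
Carron 1998, Thm. 0.3 = Thm. 3.3 (`μ_p(M)(∫_M |u|^{2p/(p-2)} dx)^{1-2/p} ≤ ∫_M |du|² dx,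
∀ u ∈ C₀^∞(M)`); the same hypothesis in Carron 1999 (as quoted in Zbl 0933.35054) and Carron 2007,
Prop. 2.11. [cite: Carron1998, Thm. 0.3] -/
def HasSobolevInequality (p μ : ℝ) : Prop :=
  ∀ u : X → ℝ, ContMDiff I 𝓘(ℝ, ℝ) ∞ u → HasCompactSupport u →
    ENNReal.ofReal μ *
        (∫⁻ x, ENNReal.ofReal (|u x| ^ (2 * p / (p - 2))) ∂(riemannianMeasure h)) ^ (1 - 2 / p) ≤
      ∫⁻ x, ENNReal.ofReal ((PseudoRiemannianMetric.ofRiemannian h).innerDual x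
        (mvfderiv I u x).toLinearMap (mvfderiv I u x).toLinearMap) ∂(riemannianMeasure h)

/-- The Sobolev inequality with constant `μ ≤ 0` is void. [folklore] -/
theorem hasSobolevInequality_of_nonpos {p μ : ℝ} (hμ : μ ≤ 0) : HasSobolevInequality h p μ := by
  intro u _ _
  simp [ENNReal.ofReal_of_nonpos hμ]

variable [(PseudoRiemannianMetric.ofRiemannian h).HasLeviCivita]

/-- **The space `ℋ¹(X, h)` of `L²` harmonic `1`-forms** of the Riemannian manifold `(X, h)`:
smooth covector fields `α` with `∫_X h⁻¹(α, α) dV_h < ∞`, `dα = 0` (`∇α` symmetric) and `d*α = 0`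
(`tr_h ∇α = 0`) — the case `Ω = X` of `relativeL2HarmonicOneForms h Ω` (no boundary, so the
relative boundary condition and the extension by zero are void: `mem_l2HarmonicOneForms_iff`).
For complete `(X, h)` it computes the reduced `L²` cohomology, `H¹₂(X) ≅ ℋ¹(X, h)` (Carron 2007,
Cor. 1.6; smoothness of weakly harmonic `L²` forms by elliptic regularity, Prop. 1.7).
Carron 2007, §1.1.3 (b) (`ℋᵏ(M) = {α ∈ L²(ΛᵏT*M), dα = 0, d*α = 0}`). [cite: Carron2007, §1.1.3 (b)] -/
abbrev l2HarmonicOneForms : Submodule ℝ (Π x : X, TangentSpace I x →L[ℝ] ℝ) :=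
  relativeL2HarmonicOneForms h ⊤

/-- Membership in `ℋ¹(X, h)`: `α` is `C^∞`, `L²`, closed and coclosed (the clauses "zero off
`closure X`" and "`ι*α = 0` on `frontier X = ∅`" of `IsRelativeL2HarmonicOneForm h ⊤` are
automatic). Carron 2007, §1.1.3 (b). [cite: Carron2007, §1.1.3 (b)] -/
theorem mem_l2HarmonicOneForms_iff {α : Π x : X, TangentSpace I x →L[ℝ] ℝ} :
    α ∈ l2HarmonicOneForms h ↔
      (∀ x, ContMDiffAt I (I.prod 𝓘(ℝ, E →L[ℝ] ℝ)) ∞ (oneFormSection α) x) ∧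
      ∫⁻ x, ENNReal.ofReal ((PseudoRiemannianMetric.ofRiemannian h).innerDual x
        (α x).toLinearMap (α x).toLinearMap) ∂(riemannianMeasure h) < ⊤ ∧
      (∀ x, ((PseudoRiemannianMetric.ofRiemannian h).covDerivOneForm α x).IsSymm) ∧
      ∀ x, (PseudoRiemannianMetric.ofRiemannian h).trace x
        ((PseudoRiemannianMetric.ofRiemannian h).covDerivOneForm α x) = 0 := by
  rw [mem_relativeL2HarmonicOneForms_iff]
  constructor
  · rintro ⟨-, hs, hL, hsy, htr, -⟩
    refine ⟨fun x ↦ ?_, ?_, fun x ↦ hsy x (by simp), fun x ↦ htr x (by simp)⟩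
    · simpa [TopologicalSpace.Opens.coe_top, contMDiffWithinAt_univ] using hs x (by simp)
    · simpa [TopologicalSpace.Opens.coe_top, Measure.restrict_univ] using hL
  · rintro ⟨hs, hL, hsy, htr⟩
    refine ⟨fun x hx ↦ ?_, fun x _ ↦ ?_, ?_, fun x _ ↦ hsy x, fun x _ ↦ htr x, fun γ _ hγ ↦ ?_⟩
    · simp [TopologicalSpace.Opens.coe_top] at hx
    · simpa [TopologicalSpace.Opens.coe_top, contMDiffWithinAt_univ] using hs x
    · simpa [TopologicalSpace.Opens.coe_top, Measure.restrict_univ] using hL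
    · have := hγ.self_of_nhds
      simp [TopologicalSpace.Opens.coe_top] at this

end L2Harmonic

/-! ### The named facts -/

/-- **Carron 1998 — ends and `L²` harmonic `1`-forms under a Sobolev inequality.** Let `(X, h)` be
a connected complete Riemannian manifold (without boundary) satisfying the Sobolev inequality
`(S_p)` with constant `μ > 0` for some `p > 2`. Then the natural map from compactly supported to
reduced `L²` cohomology in degree `1` is injective, `0 → H¹_c(X) → H¹₂(X)` (Carron 1998, Thm. 0.3
= Thm. 3.3, first assertion; Carron 2007, Prop. 2.11); consequently, since `k` ends give `k - 1`
independent classes `[duᵢ] ∈ H¹_c(X)` (Carron 2007, Lemma 2.1; proof of Carron 1998, Thm. 3.3: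
`b' - 1 ≤ dim H¹_c`), and `H¹₂(X) ≅ ℋ¹(X, h)` for complete `X` (Carron 2007, Cor. 1.6):
**if `X` has at least `k` ends then `k - 1 ≤ dim ℋ¹(X, h)`** — verbatim Cor. 4.6 of Carron's
memoir (`dim H¹(M) ≥ b - 1`, `b` the number of ends, under `(S_p)` alone). Stated with
`Module.rank` (no finiteness asserted). Carron 1998, Thm. 3.3 (first assertion and its proof,
p. 21–22); Carron 1999HdR, Prop. 4.5 and Cor. 4.6; Carron 2007, Lemma 2.1, Prop. 2.11, Cor. 1.6.
[cite: Carron1998, Thm. 3.3] -/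
def Carron1998_ends_le_rank_l2HarmonicOneForms : Prop :=
  ∀ {E : Type} [NormedAddCommGroup E] [NormedSpace ℝ E] [FiniteDimensional ℝ E] {H : Type}
    [TopologicalSpace H] (I : ModelWithCorners ℝ E H) (X : Type) [TopologicalSpace X]
    [ChartedSpace H X] [IsManifold I ∞ X] [BoundarylessManifold I X] [T3Space X]
    [SecondCountableTopology X] [MeasurableSpace X] [BorelSpace X] [ConnectedSpace X]
    (h : ContMDiffRiemannianMetric I ∞ E (TangentSpace I : X → Type _))
    [(PseudoRiemannianMetric.ofRiemannian h).HasLeviCivita] (p μ : ℝ), 2 < p → 0 < μ →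
    IsGeodesicallyComplete (PseudoRiemannianMetric.ofRiemannian h).leviCivita →
    HasSobolevInequality h p μ →
    ∀ k : ℕ, HasAtLeastEnds X k → (k : Cardinal) ≤ Module.rank ℝ (l2HarmonicOneForms h) + 1

/-- **Carron 1999 — finiteness of `ℋ¹` under a Sobolev inequality and `Ric ∈ L^{p/2}`.** For all
`n`, `p > 2`, `μ > 0` there is a constant `C = C(n, p, μ)` such that for every complete Riemannian
`n`-manifold `(X, h)` (without boundary) satisfying the Sobolev inequality `(S_p)` with constant `μ`
and `∫_X |Ric_h|^{p/2} dV_h < ∞` (`|Ric_h|² = normSq`, the Hilbert–Schmidt norm), the space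
`ℋ¹(X, h)` of `L²` harmonic `1`-forms is finite dimensional and
`dim ℋ¹(X, h) ≤ C ∫_X |Ric_h|^{p/2} dV_h`.
This is the case `k = 1` (`R_1 = Ric`, the Bochner formula `Δ₁ = ∇*∇ + Ric`) of the main theorem of
Carron 1999 as restated in Carron's memoir, Thm. 4.3: "`(S_ν)` and `∫_M |R_k|^{ν/2} < ∞` ⇒ the space
of `L²` harmonic `k`-forms is finite dimensional, `dim Hᵏ(M) ≤ C(ν,k) μ_ν(M)^{-1} ∫_M |R_k|^{ν/2}`";
the review Zbl 0933.35054 of Carron 1999 prints `dim ℋᵏ(M) ≤ Cₙᵏ C(p,n) μ_p(M)^{-p/2} ∫_M |R|^{p/2}`.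
Only the dependence `C = C(n, p, μ)` common to both printed shapes is asserted here (see the module
docstring); the proof is a Cwikel–Lieb–Rozenblum count for `∇*∇ - |R_1|` through the Kato
inequality (memoir, §4.b). Carron 1999 (Math. Ann. 314), main theorem, `k = 1`; Carron 1999HdR,
§4.b, Thm. 4.3. [cite: Carron1999HdR, Thm. 4.3] -/
def Carron1999_finrank_l2HarmonicOneForms_le : Prop :=
  ∀ (n : ℕ) (p μ : ℝ), 2 < p → 0 < μ → ∃ C : ℝ≥0,
    ∀ {E : Type} [NormedAddCommGroup E] [NormedSpace ℝ E] [FiniteDimensional ℝ E] {H : Type}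
      [TopologicalSpace H] (I : ModelWithCorners ℝ E H) (X : Type) [TopologicalSpace X]
      [ChartedSpace H X] [IsManifold I ∞ X] [BoundarylessManifold I X] [T3Space X]
      [SecondCountableTopology X] [MeasurableSpace X] [BorelSpace X]
      (h : ContMDiffRiemannianMetric I ∞ E (TangentSpace I : X → Type _))
      [(PseudoRiemannianMetric.ofRiemannian h).HasLeviCivita],
      Module.finrank ℝ E = n →
      IsGeodesicallyComplete (PseudoRiemannianMetric.ofRiemannian h).leviCivita →
      HasSobolevInequality h p μ →
      ∫⁻ x, ENNReal.ofReal (((PseudoRiemannianMetric.ofRiemannian h).normSq x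
        ((PseudoRiemannianMetric.ofRiemannian h).ricci x)) ^ (p / 4)) ∂(riemannianMeasure h) < ⊤ →
      Module.Finite ℝ (l2HarmonicOneForms h) ∧
        (Module.finrank ℝ (l2HarmonicOneForms h) : ℝ≥0∞) ≤
          C * ∫⁻ x, ENNReal.ofReal (((PseudoRiemannianMetric.ofRiemannian h).normSq x
            ((PseudoRiemannianMetric.ofRiemannian h).ricci x)) ^ (p / 4)) ∂(riemannianMeasure h)

/-- **Finitely many ends** (Carron 1998, Thm. 3.3, last assertion; memoir Cor. 4.6: "si
`∫_M |ric₋|^{ν/2} < ∞` alors `M` a un nombre fini de bouts", `b ≤ 1 + C μ⁻¹ ∫ |ric₋|^{p/2}`), in the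
shape that follows from the two facts above: for all `n`, `p > 2`, `μ > 0` there is `C = C(n, p, μ)`
such that a connected complete Riemannian `n`-manifold with `(S_p)`, constant `μ`, and
`∫ |Ric|^{p/2} < ∞` has at most `1 + C ∫_X |Ric_h|^{p/2} dV_h` ends. Proved from
`Carron1998_ends_le_rank_l2HarmonicOneForms` and `Carron1999_finrank_l2HarmonicOneForms_le`.
[cite: Carron1998, Thm. 3.3] -/
theorem ends_le_of_Carron1998_of_Carron1999 (h1 : Carron1998_ends_le_rank_l2HarmonicOneForms)
    (h2 : Carron1999_finrank_l2HarmonicOneForms_le) (n : ℕ) {p μ : ℝ} (hp : 2 < p) (hμ : 0 < μ) :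
    ∃ C : ℝ≥0,
    ∀ {E : Type} [NormedAddCommGroup E] [NormedSpace ℝ E] [FiniteDimensional ℝ E] {H : Type}
      [TopologicalSpace H] (I : ModelWithCorners ℝ E H) (X : Type) [TopologicalSpace X]
      [ChartedSpace H X] [IsManifold I ∞ X] [BoundarylessManifold I X] [T3Space X]
      [SecondCountableTopology X] [MeasurableSpace X] [BorelSpace X] [ConnectedSpace X]
      (h : ContMDiffRiemannianMetric I ∞ E (TangentSpace I : X → Type _))
      [(PseudoRiemannianMetric.ofRiemannian h).HasLeviCivita],
      Module.finrank ℝ E = n →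
      IsGeodesicallyComplete (PseudoRiemannianMetric.ofRiemannian h).leviCivita →
      HasSobolevInequality h p μ →
      ∫⁻ x, ENNReal.ofReal (((PseudoRiemannianMetric.ofRiemannian h).normSq x
        ((PseudoRiemannianMetric.ofRiemannian h).ricci x)) ^ (p / 4)) ∂(riemannianMeasure h) < ⊤ →
      ∀ k : ℕ, HasAtLeastEnds X k →
        (k : ℝ≥0∞) ≤ 1 + C * ∫⁻ x, ENNReal.ofReal (((PseudoRiemannianMetric.ofRiemannian h).normSq x
            ((PseudoRiemannianMetric.ofRiemannian h).ricci x)) ^ (p / 4)) ∂(riemannianMeasure h) := by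
  obtain ⟨C, hC⟩ := h2 n p μ hp hμ
  refine ⟨C, ?_⟩
  intro E _ _ _ H _ I X _ _ _ _ _ _ _ _ _ h _ hn hc hS hRic k hk
  obtain ⟨hfin, hle⟩ := hC I X h hn hc hS hRic
  have hk' : (k : Cardinal) ≤ Module.rank ℝ (l2HarmonicOneForms h) + 1 :=
    h1 I X h p μ hp hμ hc hS k hk
  rw [← Module.finrank_eq_rank] at hk'
  norm_cast at hk'
  calc (k : ℝ≥0∞) ≤ ((Module.finrank ℝ (l2HarmonicOneForms h) + 1 : ℕ) : ℝ≥0∞) := by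
        exact_mod_cast hk'
    _ = 1 + (Module.finrank ℝ (l2HarmonicOneForms h) : ℝ≥0∞) := by push_cast; ring
    _ ≤ 1 + C * ∫⁻ x, ENNReal.ofReal (((PseudoRiemannianMetric.ofRiemannian h).normSq x
          ((PseudoRiemannianMetric.ofRiemannian h).ricci x)) ^ (p / 4)) ∂(riemannianMeasure h) :=
        add_le_add le_rfl hle

end Literature.Geometry.Riemannian

end
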